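import Literature.AlgebraicGeometry.Motives.EllAdicComparisonLimOneProofs
import HarnessLib

/-!
# Globalization for Bhatt–Scholze Cor. 5.1.6: degenerate Leray for `ν : X_proét → X_ét`, and
# `Hᵖ = 0` from section lifting along injective cosyzygies

The pro-étale/étale comparison `nonempty_addEquiv_sheafH_etaleToProetPullback` (Bhatt–Scholze
Cor. 5.1.6, `EtaleToProet.lean`) — and through it `ellAdicCohomology_limOneSequence`
(Prop. 5.6.2, `EllAdicComparisonLimOneProofs.lean`) — is reduced in this cluster to the
acyclicity `(c)`: `Hᵖ⁺¹(X_proét, ν*(ulift I)) = 0` for every scheme `X` and every injective `I` of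
`Shv(X_ét, Ab.{u})` (`EtaleToProetExt.lean`, hypothesis `hc`). The printed proof (arXiv p. 30)
proves the *affine* statement "`Hᵖ(U, ν*I) = 0` for `U ∈ X_proét^aff`" by Cartan's criterion and
Čech cohomology over ind-étale covers, and globalizes in one sentence: "The first part follows
from the second part by checking it on sections using Lemma 4.2.4", i.e. `K ≃ ν_*ν*K` is local on
`X_ét` and `RΓ(X_proét, ν*K) = RΓ(X_ét, ν_*ν*K)` (Leray). On Mathlib's carriers
(`Hᵖ = Sheaf.H = Extᵖ(ℤ, –)` in the derived category, no `Rν_*`, no cohomology of objects of a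
site) this globalization is a theorem to be proved; this file proves it, in a form that consumes
the affine statement *as section lifting* and is independent of how that statement is obtained:

* `subsingleton_ext_of_adjunction` — **`Ext`-vanishing transfer along an adjunction** `L ⊣ R`
  with `L` preserving monomorphisms: if `𝒢 ⊆ ℬ` is stable under injective cosyzygies and `R` is
  exact on the short exact sequences `0 → G → J → Q → 0`, `G ∈ 𝒢`, `J` injective, then for
  `G ∈ 𝒢`, `Extⁿ⁺¹(A, RG) = 0 ∀ n` implies `Extⁿ⁺¹(LA, G) = 0 ∀ n` (degenerate Grothendieck
  spectral sequence, by dimension shifting: `ext_one_eq_zero_of_adjunction` in degree one);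
* `IsLiftingClass J 𝔘 𝒢`, `liftable J 𝔘` — **lifting classes** of abelian sheaves on a site:
  stable under injective cosyzygies, with sections over the objects of `𝔘` lifting along `J → Q`;
  the largest one; `subsingleton_sheafH_of_isLiftingClass`: **`Hᵖ(F) = 0`, `p > 0`, for `F` in a
  lifting class over a terminal object** (`constantSheaf ⊣ Γ(T, –)`, `ℤ` projective in `Ab`);
* `IsEtaleLiftingClass X 𝒢`, `etaleAcyclic X` — on `X_proét`, lifting over the affine étale
  objects `etaleAffineObjects X`; `shortExact_map_proetToEtalePushforward`: **`ν_*` is exact on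
  `0 → G → J → Q → 0`** for `G` in an étale lifting class (lift over affine opens, which cover in
  `X_ét`; `ν_*` is left exact);
* `subsingleton_sheafH_etaleToProetPullback_of_mem` — **degenerate Leray for `ν`**: if `ν*F` is
  étale-acyclic and `Hᵖ(X_ét, F) = 0` for `p > 0` then `Hᵖ(X_proét, ν*F) = 0` for `p > 0`
  (`ν* ⊣ ν_*`, `ν*` exact and fully faithful, `ν*ℤ = ℤ`);
  `subsingleton_sheafH_of_isEtaleLiftingClass_of_isAffine`: for affine `X` étale acyclicity alone
  suffices;
* the assembly: **`(c)`, Cor. 5.1.6 and Prop. 5.6.2 follow from**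
  **(A)** `ν*(ulift I) ∈ etaleAcyclic X` — the sections of the iterated injective cosyzygies of
  `ν*(ulift I)` on `X_proét` lift over affine étale objects: the printed affine statement, read
  for the affine *étale* `U`, in the section-lifting form in which Cartan's criterion produces it —
  and **(B)** `Hᵖ(X_ét, ulift I) = 0` for `p > 0` in `Shv(X_ét, Ab.{u+1})` — the coefficient
  universe change on injectives, equivalently (`subsingleton_sheafH_etale_of_mem_liftable`)
  liftability of `ulift I` over the final object of `X_ét`, which is Cartan's criterion on `X_ét`
  for all covers applied to the Čech-acyclic `ulift I` (Milne III 2.4,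
  `Literature.Algebra.Homology.cechCochainComplex_exactAt_succ_of_injective`):
  `subsingleton_sheafH_etaleToProetPullbackULift_of_etaleAcyclic`,
  `nonempty_addEquiv_sheafH_etaleToProetPullback_of_etaleAcyclic`,
  `ellAdicCohomology_limOneSequence_of_etaleAcyclic`.

So the residual proof obligation of Cor. 5.1.6 / Prop. 5.6.2 in this tree is now exactly the
AFFINE content of the printed proof — Cartan's criterion in lifting form (Stacks 03F9: lifting from
`Ȟ¹ = 0`, stability under cosyzygies from the long exact Čech sequence) fed with (A') the
cofinality of ind-étale covers among pro-étale covers of a pro-étale affine (Thm. 2.3.4) and the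
colimit formula for the Čech complexes of `ν*I` on them (Lemma 5.1.1, proved, and Milne III 2.4,
proved), and with (B') all étale covers of `X`.

## References

* B. Bhatt, P. Scholze, *The pro-étale topology for schemes*, Astérisque 369 (2015)
  (arXiv:1309.1198, held): Lemma 5.1.2, Cor. 5.1.6 and its proof (p. 30: "The first part follows
  from the second part by checking it on sections … it suffices to prove: `Hᵖ(U, ν*I) = 0` for
  `I ∈ Ab(X_ét)` injective, `p > 0`, and `U ∈ X_proét^aff`. By [SGA4, V.4.3] …"), Prop. 5.6.2.
  [BhattScholze2015]
* M. Artin, A. Grothendieck, J.-L. Verdier, *SGA 4*, Exp. V (Verdier): Prop. 4.3 (Cartan's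
  criterion), §5 (Leray spectral sequence of a morphism of topoi). [folklore]
* The Stacks Project, Tag 03F9 (vanishing from Čech vanishing on a basis: the proof by lifting of
  sections and stability under injective cosyzygies). [StacksProject]

## Design notes

* Only theorems and real definitions (D-0026): the inputs (A), (B) are explicit hypotheses of the
  assembly theorems, phrased as membership in `liftable _ _` — never named facts.
* Why lifting classes. Mathlib's cohomology of an object `Sheaf.H'`/`cohomologyPresheaf` needs
  coefficients in `Ab.{v}` for `v` the morphism universe of the site, which excludes
  `Shv(X_proét, Ab.{u+1})`; and any cohomology theory of objects turns "`Hᵖ(U, G) = 0` for `p > 0`,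
  `U ∈ 𝔘`" into exactly: sections over `U ∈ 𝔘` lift along `J → Q` for every injective cosyzygy
  sequence of `G` (`H¹` = obstruction to lifting, `Hᵖ⁺¹(G) = Hᵖ(Q)`). The class formulation is what
  the dimension shifting of `subsingleton_ext_of_adjunction` consumes and what Cartan's criterion
  produces, so producer and consumer need not agree on a definition of `Hᵖ(U, –)`.
* `IsGrothendieckAbelian (Sheaf X.smallEtaleTopology Ab.{u+1})` is registered here (as Mathlib
  does for `X.ProEt`), giving `HasExt.{u+1}` and enough injectives in the coefficient universe of
  `ν_*`; `HasExt` being a proposition, no instance diamond can arise.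
* (B) cannot be bypassed by working with `ν* ∘ ulift` directly: `ulift : Shv(Ab.{u}) → Shv(Ab.{u+1})`
  has no right adjoint, and the dimension shifting along `ulift`
  (`Literature.Algebra.Homology.mapExt_bijective_of_subsingleton_ext_obj_injective`) needs (B) as
  its own acyclicity input. For affine `X` (B) is not needed
  (`subsingleton_sheafH_etaleToProetPullbackULift_of_etaleAcyclic_of_isAffine`).
* Mathlib searches: `Ext.covariant_sequence_exact₁/₃`, `Injective.injective_of_adjoint`,
  `Functor.preservesFiniteLimits_iff_forall_exact_map_and_mono`, `constantSheafAdj`,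
  `Adjunction.unit_isIso_of_L_fully_faithful`, `Sheaf.isLocallySurjective_iff_epi'`; no Leray /
  Grothendieck spectral sequence, no `Ext`-adjunction lemma, no acyclic objects in Mathlib.
  Nothing restated.
-/

universe w₁ w₂ v₁ v₂ u₁ u₂ u

open CategoryTheory Limits Opposite AlgebraicGeometry

noncomputable section

namespace Literature.AlgebraicGeometry.Motives

/-! ### `Ext`-vanishing transfer along an adjunction with exact left adjoint -/

section Abstract

variable {𝒜 : Type u₁} [Category.{v₁} 𝒜] [Abelian 𝒜] {ℬ : Type u₂} [Category.{v₂} ℬ] [Abelian ℬ]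
  [HasExt.{w₁} 𝒜] [HasExt.{w₂} ℬ] {L : 𝒜 ⥤ ℬ} {R : ℬ ⥤ 𝒜} [R.Additive]

/-- **Degree one.** Let `L ⊣ R`, `0 → G → J → Q → 0` short exact in `ℬ` with `J`
injective and `0 → RG → RJ → RQ → 0` still short exact in `𝒜`. If `Ext¹(A, RG) = 0` then
`Ext¹(LA, G) = 0`: a class in `Ext¹(LA, G)` comes from a morphism `LA → Q` (the next term
`Ext¹(LA, J)` vanishes), whose adjoint `A → RQ` lifts to `A → RJ` because `Ext¹(A, RG) = 0`; the
adjoint lift `LA → J` kills the class. [folklore] -/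
theorem ext_one_eq_zero_of_adjunction (adj : L ⊣ R) {S : ShortComplex ℬ} (hS : S.ShortExact)
    (hJ : Injective S.X₂) (hRS : (S.map R).ShortExact) (A : 𝒜)
    (hA : Subsingleton (Abelian.Ext.{w₁} A (R.obj S.X₁) 1))
    (x : Abelian.Ext.{w₂} (L.obj A) S.X₁ 1) : x = 0 := by
  haveI := hJ
  obtain ⟨x₃, rfl⟩ := Abelian.Ext.covariant_sequence_exact₁ (L.obj A) hS x
    (Abelian.Ext.eq_zero_of_injective _) (zero_add 1)
  obtain ⟨φ, rfl⟩ := Abelian.Ext.homEquiv₀.symm.surjective x₃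
  -- the adjoint morphism `A → R Q` lifts to `A → R J`
  let y₃ : Abelian.Ext.{w₁} A (S.map R).X₃ 0 := Abelian.Ext.mk₀ (adj.homEquiv A S.X₃ φ)
  obtain ⟨y₂, hy₂⟩ := Abelian.Ext.covariant_sequence_exact₃ A hRS y₃ (zero_add 1)
    (@Subsingleton.elim _ hA _ _)
  obtain ⟨(ψ' : A ⟶ R.obj S.X₂), rfl⟩ := Abelian.Ext.homEquiv₀.symm.surjective y₂
  have hψ' : ψ' ≫ R.map S.g = adj.homEquiv A S.X₃ φ := by
    apply (Abelian.Ext.mk₀_bijective _ _).1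
    rw [← Abelian.Ext.mk₀_comp_mk₀]
    exact hy₂
  have hφ : (adj.homEquiv A S.X₂).symm ψ' ≫ S.g = φ := by
    rw [← Adjunction.homEquiv_naturality_right_symm, Equiv.symm_apply_eq]
    exact hψ'
  change (Abelian.Ext.mk₀ φ).comp hS.extClass (zero_add 1) = 0
  rw [← hφ, ← Abelian.Ext.mk₀_comp_mk₀, Abelian.Ext.comp_assoc_of_second_deg_zero,
    hS.comp_extClass, Abelian.Ext.comp_zero]

omit [HasExt.{w₂} ℬ] in
/-- If `R J` is injective and `0 → RG → RJ → RQ → 0` is short exact, the vanishing of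
`Extⁿ⁺¹(A, RG)` for all `n` passes to `RQ`. [folklore] -/
theorem subsingleton_ext_map_X₃_of_subsingleton {S : ShortComplex ℬ} (hRS : (S.map R).ShortExact)
    (hRJ : Injective (R.obj S.X₂)) (A : 𝒜)
    (hA : ∀ n : ℕ, Subsingleton (Abelian.Ext.{w₁} A (R.obj S.X₁) (n + 1))) (n : ℕ) :
    Subsingleton (Abelian.Ext.{w₁} A (R.obj S.X₃) (n + 1)) := by
  haveI : Injective (S.map R).X₂ := hRJ
  refine subsingleton_of_forall_eq 0 fun y => ?_
  obtain ⟨y₂, rfl⟩ := Abelian.Ext.covariant_sequence_exact₃ A hRS y (rfl : n + 1 + 1 = n + 2)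
    (@Subsingleton.elim _ (hA (n + 1)) _ _)
  rw [show y₂ = 0 from Abelian.Ext.eq_zero_of_injective _, Abelian.Ext.zero_comp]
  rfl

variable [EnoughInjectives ℬ] [L.PreservesMonomorphisms]

/-- **`Ext`-vanishing transfer along an adjunction** (degenerate Leray / Grothendieck spectral
sequence, proved by dimension shifting). Let `L ⊣ R` be an adjunction between abelian categories
with `L` preserving monomorphisms (e.g. `L` exact; then `R` preserves injectives) and `ℬ` with
enough injectives, and let `𝒢` be a class of objects of `ℬ` such
that for every short exact `0 → G → J → Q → 0` with `G ∈ 𝒢` and `J` injective, `Q ∈ 𝒢` and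
`0 → RG → RJ → RQ → 0` is short exact ("`R` is exact on injective cosyzygies inside `𝒢`", i.e.
the members of `𝒢` are `R`-acyclic). Then for `G ∈ 𝒢` and any `A`:
`Extⁿ⁺¹(A, RG) = 0` for all `n` implies `Extⁿ⁺¹(LA, G) = 0` for all `n`. (Classically:
`Extⁿ(LA, G) = Extⁿ(A, R G)` when `Rⁱ R (G) = 0` for `i > 0`, e.g. SGA 4 V 5.3 / the Leray
spectral sequence of a morphism of topoi; only the vanishing statement is recorded.) [folklore] -/
theorem subsingleton_ext_of_adjunction (adj : L ⊣ R) (𝒢 : Set ℬ)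
    (h𝒢 : ∀ S : ShortComplex ℬ, S.ShortExact → Injective S.X₂ → S.X₁ ∈ 𝒢 →
      S.X₃ ∈ 𝒢 ∧ (S.map R).ShortExact)
    (A : 𝒜) (n : ℕ) :
    ∀ G : ℬ, G ∈ 𝒢 → (∀ m : ℕ, Subsingleton (Abelian.Ext.{w₁} A (R.obj G) (m + 1))) →
      Subsingleton (Abelian.Ext.{w₂} (L.obj A) G (n + 1)) := by
  induction n with
  | zero =>
    intro G hG hA
    let ip : InjectivePresentation G := Classical.arbitrary _
    let S : ShortComplex ℬ := ShortComplex.mk ip.f (cokernel.π ip.f) (cokernel.condition ip.f)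
    have hS : S.ShortExact := { exact := ShortComplex.exact_cokernel ip.f }
    obtain ⟨-, hRS⟩ := h𝒢 S hS ip.injective hG
    exact subsingleton_of_forall_eq 0
      (ext_one_eq_zero_of_adjunction adj hS ip.injective hRS A (hA 0))
  | succ n ih =>
    intro G hG hA
    let ip : InjectivePresentation G := Classical.arbitrary _
    let S : ShortComplex ℬ := ShortComplex.mk ip.f (cokernel.π ip.f) (cokernel.condition ip.f)
    have hS : S.ShortExact := { exact := ShortComplex.exact_cokernel ip.f }
    obtain ⟨hQ, hRS⟩ := h𝒢 S hS ip.injective hG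
    haveI := ih S.X₃ hQ (subsingleton_ext_map_X₃_of_subsingleton hRS
      (Injective.injective_of_adjoint adj S.X₂) A hA)
    haveI := ip.injective
    refine subsingleton_of_forall_eq 0 fun x => ?_
    obtain ⟨x₃, rfl⟩ := Abelian.Ext.covariant_sequence_exact₁ (L.obj A) hS x
      (Abelian.Ext.eq_zero_of_injective _) (rfl : n + 1 + 1 = n + 2)
    rw [Subsingleton.elim x₃ 0, Abelian.Ext.zero_comp]

end Abstract

/-! ### Transport of `Ext` along an isomorphism of the target -/

/-- `Extⁿ(A, Y) ≃+ Extⁿ(A, Y')` for `e : Y ≅ Y'` (postcomposition with `e.hom`). [folklore] -/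
def extAddEquivOfIsoRight {C : Type*} [Category C] [Abelian C] [HasExt.{w₁} C] {A Y Y' : C}
    (e : Y ≅ Y') (n : ℕ) : Abelian.Ext A Y n ≃+ Abelian.Ext A Y' n where
  toFun := (Abelian.Ext.mk₀ e.hom).postcomp A (add_zero n)
  invFun := (Abelian.Ext.mk₀ e.inv).postcomp A (add_zero n)
  left_inv α := by simp [Abelian.Ext.comp_assoc_of_second_deg_zero, Abelian.Ext.mk₀_comp_mk₀]
  right_inv α := by simp [Abelian.Ext.comp_assoc_of_second_deg_zero, Abelian.Ext.mk₀_comp_mk₀]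
  map_add' := map_add _

/-! ### Lifting classes of abelian sheaves on a site -/

section LiftingClass

variable {C : Type u₁} [Category.{v₁} C] (J : GrothendieckTopology C)

/-- **A lifting class over `𝔘`**: a class `𝒢` of abelian sheaves on the site `(C, J)` such that
for every short exact `0 → G → I → Q → 0` with `G ∈ 𝒢` and `I` injective, again `Q ∈ 𝒢`, and
every section of `Q` over an object of `𝔘` lifts to `I`. This is the section-level content of
"`Hᵖ(U, G') = 0` for all `p > 0`, all `U ∈ 𝔘` and all iterated injective cosyzygies `G'` of
`G`" — the members of a lifting class are `Γ(U, –)`-acyclic for `U ∈ 𝔘` — stated without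
choosing a cohomology theory for the objects of the site (it is the form in which Cartan's
criterion, SGA 4 V 4.3 / Stacks 03F9, produces acyclicity: lifting of sections from the
vanishing of `Ȟ¹`, and stability under cosyzygies from the long exact Čech sequence). [folklore] -/
structure IsLiftingClass (𝔘 : Set C) (𝒢 : Set (Sheaf J AddCommGrpCat.{w₁})) : Prop where
  /-- the class is stable under injective cosyzygies -/
  mem : ∀ S : ShortComplex (Sheaf J AddCommGrpCat.{w₁}), S.ShortExact → Injective S.X₂ →
    S.X₁ ∈ 𝒢 → S.X₃ ∈ 𝒢
  /-- sections over the objects of `𝔘` lift along `I → Q` -/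
  surjective : ∀ S : ShortComplex (Sheaf J AddCommGrpCat.{w₁}), S.ShortExact → Injective S.X₂ →
    S.X₁ ∈ 𝒢 → ∀ U ∈ 𝔘, Function.Surjective (S.g.hom.app (op U))

variable {J}

/-- A union of lifting classes is a lifting class. [folklore] -/
theorem IsLiftingClass.sUnion {𝔘 : Set C} (T : Set (Set (Sheaf J AddCommGrpCat.{w₁})))
    (hT : ∀ 𝒢 ∈ T, IsLiftingClass J 𝔘 𝒢) : IsLiftingClass J 𝔘 (⋃₀ T) where
  mem S hS hI hG := by
    obtain ⟨𝒢, h𝒢, hG⟩ := Set.mem_sUnion.1 hG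
    exact Set.mem_sUnion.2 ⟨𝒢, h𝒢, (hT 𝒢 h𝒢).mem S hS hI hG⟩
  surjective S hS hI hG U hU := by
    obtain ⟨𝒢, h𝒢, hG⟩ := Set.mem_sUnion.1 hG
    exact (hT 𝒢 h𝒢).surjective S hS hI hG U hU

/-- Lifting classes over `𝔘` are lifting classes over every smaller `𝔘'`. [folklore] -/
theorem IsLiftingClass.anti {𝔘 𝔘' : Set C} (h : 𝔘' ⊆ 𝔘) {𝒢 : Set (Sheaf J AddCommGrpCat.{w₁})}
    (h𝒢 : IsLiftingClass J 𝔘 𝒢) : IsLiftingClass J 𝔘' 𝒢 where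
  mem := h𝒢.mem
  surjective S hS hI hG U hU := h𝒢.surjective S hS hI hG U (h hU)

variable (J) in
/-- **`𝔘`-liftable sheaves**: the largest lifting class over `𝔘` (the union of all of them); a
sheaf is `𝔘`-liftable iff it belongs to some lifting class over `𝔘`. [folklore] -/
def liftable (𝔘 : Set C) : Set (Sheaf J AddCommGrpCat.{w₁}) :=
  ⋃₀ {𝒢 | IsLiftingClass J 𝔘 𝒢}

/-- The `𝔘`-liftable sheaves form a lifting class over `𝔘`. [folklore] -/
theorem isLiftingClass_liftable (𝔘 : Set C) : IsLiftingClass J 𝔘 (liftable J 𝔘) :=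
  IsLiftingClass.sUnion _ fun _ h => h

/-- A member of a lifting class over `𝔘` is `𝔘`-liftable. [folklore] -/
theorem mem_liftable_of_mem {𝔘 : Set C} {𝒢 : Set (Sheaf J AddCommGrpCat.{w₁})}
    (h𝒢 : IsLiftingClass J 𝔘 𝒢) {G : Sheaf J AddCommGrpCat.{w₁}} (hG : G ∈ 𝒢) :
    G ∈ liftable J 𝔘 :=
  Set.mem_sUnion.2 ⟨𝒢, h𝒢, hG⟩

/-- `liftable` is antitone in `𝔘`. [folklore] -/
theorem liftable_anti {𝔘 𝔘' : Set C} (h : 𝔘' ⊆ 𝔘) :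
    (liftable J 𝔘 : Set (Sheaf J AddCommGrpCat.{w₁})) ⊆ liftable J 𝔘' :=
  fun _ hG => by
    obtain ⟨𝒢, h𝒢, hG⟩ := Set.mem_sUnion.1 hG
    exact mem_liftable_of_mem (h𝒢.anti h) hG

/-! ### Vanishing of `Hᵖ(F)` for `F` in a lifting class over a terminal object -/

variable [HasSheafify J AddCommGrpCat.{w₁}] [HasExt.{w₂} (Sheaf J AddCommGrpCat.{w₁})]
  [EnoughInjectives (Sheaf J AddCommGrpCat.{w₁})]

/-- **`Hᵖ(F) = 0` (`p > 0`) for `F` in a lifting class over a terminal object `T`.** Mathlib's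
`Sheaf.H F p = Extᵖ(ℤ, F)` with `ℤ` the constant sheaf, left adjoint image of the projective group
`ℤ` under `constantSheaf ⊣ Γ(T, –)` (Mathlib `constantSheafAdj`); the `Ext`-vanishing transfer
`subsingleton_ext_of_adjunction` applies because `Γ(T, –)` is exact on the injective cosyzygies
of `F` (lifting over `T ∈ 𝔘`) and `Extᵖ_{Ab}(ℤ, –) = 0` for `p > 0`. (The derived-functor
statement: a `Γ(T, –)`-acyclic sheaf has no higher cohomology.) [folklore] -/
theorem subsingleton_sheafH_of_isLiftingClass {T : C} (hT : IsTerminal T) {𝔘 : Set C}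
    (hT𝔘 : T ∈ 𝔘) {𝒢 : Set (Sheaf J AddCommGrpCat.{w₁})} (h𝒢 : IsLiftingClass J 𝔘 𝒢)
    (F : Sheaf J AddCommGrpCat.{w₁}) (hF : F ∈ 𝒢) (p : ℕ) : Subsingleton (F.H p.succ) := by
  haveI : PreservesFiniteLimits (constantSheaf J AddCommGrpCat.{w₁}) :=
    comp_preservesFiniteLimits (Functor.const Cᵒᵖ) (presheafToSheaf J _)
  haveI : PreservesFiniteLimits ((sheafSections J AddCommGrpCat.{w₁}).obj (op T)) := by
    haveI : PreservesLimitsOfSize.{0, 0} ((sheafSections J AddCommGrpCat.{w₁}).obj (op T)) :=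
      (constantSheafAdj J AddCommGrpCat.{w₁} hT).rightAdjoint_preservesLimits
    exact PreservesLimitsOfSize.preservesFiniteLimits _
  haveI : ((sheafSections J AddCommGrpCat.{w₁}).obj (op T)).Additive := ⟨rfl⟩
  refine subsingleton_ext_of_adjunction (constantSheafAdj J AddCommGrpCat.{w₁} hT) 𝒢
    (fun S hS hI hG => ⟨h𝒢.mem S hS hI hG, ?_⟩) (AddCommGrpCat.of (ULift ℤ)) p F hF
    (fun m => ?_)
  · -- `Γ(T, –)` is exact on `0 → G → I → Q → 0`
    obtain ⟨hex, hmono⟩ := (((sheafSections J AddCommGrpCat.{w₁}).obj (op T))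
      |>.preservesFiniteLimits_iff_forall_exact_map_and_mono).1 inferInstance S hS
    haveI : Mono (S.map ((sheafSections J AddCommGrpCat.{w₁}).obj (op T))).f := hmono
    haveI : Epi (S.map ((sheafSections J AddCommGrpCat.{w₁}).obj (op T))).g :=
      (AddCommGrpCat.epi_iff_surjective _).2 (h𝒢.surjective S hS hI hG T hT𝔘)
    exact { exact := hex }
  · -- `Extᵐ⁺¹_{Ab}(ℤ, –) = 0`
    haveI := projective_uliftInt.{w₁}
    exact Abelian.Ext.subsingleton_of_projective _ _ _

/-- The same for the liftable sheaves over any `𝔘` containing a terminal object. [folklore] -/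
theorem subsingleton_sheafH_of_mem_liftable {T : C} (hT : IsTerminal T) {𝔘 : Set C}
    (hT𝔘 : T ∈ 𝔘) (F : Sheaf J AddCommGrpCat.{w₁}) (hF : F ∈ liftable J 𝔘) (p : ℕ) :
    Subsingleton (F.H p.succ) :=
  subsingleton_sheafH_of_isLiftingClass hT hT𝔘 (isLiftingClass_liftable 𝔘) F hF p

end LiftingClass

/-! ### The étale lifting classes on `X_proét` -/

section Site

variable (X : Scheme.{u})

/-- `Shv(X_ét, Ab.{u+1})` is Grothendieck abelian (the site `X.Etale` is `u+1`-small), so that it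
has `Ext`-groups and enough injectives; this is the coefficient universe of `ν_*` / `ν*`
(`EtaleToProet.lean`), cf. Mathlib's instance for `X.ProEt` in `Sites/ElladicCohomology.lean`.
[folklore] -/
instance isGrothendieckAbelian_etaleSheaf :
    IsGrothendieckAbelian.{u + 1} (Sheaf X.smallEtaleTopology Ab.{u + 1}) := by
  have : EssentiallySmall.{u + 1} X.Etale := inferInstance
  exact Sheaf.isGrothendieckAbelian_of_essentiallySmall X.smallEtaleTopology Ab.{u + 1}

/-- The affine étale `X`-schemes, as objects of `X_proét` (`etaleToProet`). [folklore] -/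
def etaleAffineObjects : Set X.ProEt :=
  Set.range fun V : {V : X.Etale // IsAffine V.left} => (etaleToProet X).obj V.1

variable {X}

/-- `ν V ∈ etaleAffineObjects X` for `V` affine. [folklore] -/
theorem etaleToProet_obj_mem_etaleAffineObjects (V : X.Etale) [hV : IsAffine V.left] :
    (etaleToProet X).obj V ∈ etaleAffineObjects X :=
  ⟨⟨V, hV⟩, rfl⟩

/-- **An étale lifting class** on `X_proét`: a lifting class over the affine étale objects — for
every short exact `0 → G → J → Q → 0` with `G ∈ 𝒢` and `J` injective, again `Q ∈ 𝒢`, and every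
section of `Q` over an *affine* étale `X`-scheme `V` (viewed in `X_proét`) lifts to `J`. This is
the section-level content of Bhatt–Scholze's "`Hᵖ(U, ν*I) = 0` for `U ∈ X_proét^aff`, `p > 0`"
(proof of Cor. 5.1.6) read for the affine *étale* `U` and the iterated injective cosyzygies of
`ν*I`. [cite: BhattScholze2015, Cor. 5.1.6 (proof)] -/
abbrev IsEtaleLiftingClass (X : Scheme.{u}) (𝒢 : Set (Sheaf (Scheme.ProEt.topology X) Ab.{u + 1})) :
    Prop :=
  IsLiftingClass (Scheme.ProEt.topology X) (etaleAffineObjects X) 𝒢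

variable (X) in
/-- **Étale-acyclic pro-étale sheaves**: the largest étale lifting class. [folklore] -/
abbrev etaleAcyclic : Set (Sheaf (Scheme.ProEt.topology X) Ab.{u + 1}) :=
  liftable (Scheme.ProEt.topology X) (etaleAffineObjects X)

/-! ### `ν_*` is exact on injective cosyzygies inside an étale lifting class -/

/-- The open subscheme `W ⊆ U` of an étale `X`-scheme is affine when `W` is an affine open.
[folklore] -/
theorem isAffine_etOfOpens_left (U : X.Etale) (W : U.left.affineOpens) :
    IsAffine (etOfOpens U W.1).left :=
  W.2

/-- **`ν_*(J → Q)` is an epimorphism of étale sheaves** for `0 → G → J → Q → 0` short exact with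
`J` injective and `G` in an étale lifting class: a section of `Q` over an étale `U` lifts to `J`
over every affine open of `U`, and the affine opens cover `U` in `X_ét`. [folklore] -/
theorem epi_proetToEtalePushforward_map_g
    {𝒢 : Set (Sheaf (Scheme.ProEt.topology X) Ab.{u + 1})} (h𝒢 : IsEtaleLiftingClass X 𝒢)
    {S : ShortComplex (Sheaf (Scheme.ProEt.topology X) Ab.{u + 1})} (hS : S.ShortExact)
    (hJ : Injective S.X₂) (hG : S.X₁ ∈ 𝒢) :
    Epi ((proetToEtalePushforward X Ab.{u + 1}).map S.g) := by
  have hls : Presheaf.IsLocallySurjective X.smallEtaleTopology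
      ((proetToEtalePushforward X Ab.{u + 1}).map S.g).hom := by
    constructor
    intro U s
    refine GrothendieckTopology.superset_covering _ ?_
      (ofArrows_etOfOpensι_mem U (fun W : U.left.affineOpens => W.1) fun x => ?_)
    · rw [Sieve.ofArrows, Sieve.generate_le_iff]
      rintro _ _ ⟨W⟩
      haveI := isAffine_etOfOpens_left U W
      obtain ⟨t, ht⟩ := h𝒢.surjective S hS hJ hG _
        (etaleToProet_obj_mem_etaleAffineObjects (etOfOpens U W.1))
        (S.X₃.obj.map ((etaleToProet X).map (etOfOpensι U W.1)).op s)
      exact ⟨t, ht⟩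
    · obtain ⟨W, hW, hxW, -⟩ := TopologicalSpace.Opens.isBasis_iff_nbhd.1
        U.left.isBasis_affineOpens (show x ∈ (⊤ : U.left.Opens) from trivial)
      exact ⟨⟨W, hW⟩, hxW⟩
  haveI : Sheaf.IsLocallySurjective ((proetToEtalePushforward X Ab.{u + 1}).map S.g) := hls
  exact (Sheaf.isLocallySurjective_iff_epi' AddCommGrpCat.{u + 1}
    ((proetToEtalePushforward X Ab.{u + 1}).map S.g)).1 this

/-- `ν_*` is left exact (a right adjoint). [folklore] -/
instance preservesFiniteLimits_proetToEtalePushforward :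
    PreservesFiniteLimits (proetToEtalePushforward X Ab.{u + 1}) :=
  haveI : PreservesLimitsOfSize.{0, 0} (proetToEtalePushforward X Ab.{u + 1}) :=
    (etaleToProetAdjunction X).rightAdjoint_preservesLimits
  PreservesLimitsOfSize.preservesFiniteLimits _

/-- **`ν_*` is exact on `0 → G → J → Q → 0`** (`J` injective, `G` in an étale lifting class):
left exactness of the right adjoint `ν_*` and `epi_proetToEtalePushforward_map_g`. [folklore] -/
theorem shortExact_map_proetToEtalePushforward
    {𝒢 : Set (Sheaf (Scheme.ProEt.topology X) Ab.{u + 1})} (h𝒢 : IsEtaleLiftingClass X 𝒢)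
    {S : ShortComplex (Sheaf (Scheme.ProEt.topology X) Ab.{u + 1})} (hS : S.ShortExact)
    (hJ : Injective S.X₂) (hG : S.X₁ ∈ 𝒢) :
    (S.map (proetToEtalePushforward X Ab.{u + 1})).ShortExact := by
  obtain ⟨hex, hmono⟩ := ((proetToEtalePushforward X Ab.{u + 1})
    |>.preservesFiniteLimits_iff_forall_exact_map_and_mono).1 inferInstance S hS
  haveI : Mono (S.map (proetToEtalePushforward X Ab.{u + 1})).f := hmono
  haveI : Epi (S.map (proetToEtalePushforward X Ab.{u + 1})).g :=
    epi_proetToEtalePushforward_map_g h𝒢 hS hJ hG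
  exact { exact := hex }

/-! ### Degenerate Leray: `Hᵖ(X_proét, ν*F) = 0` from étale acyclicity and `Hᵖ(X_ét, F) = 0` -/

/-- **`Hᵖ(X_proét, G) = 0` for `G` étale-acyclic and `X` affine**, `p > 0`: `X` itself is then an
affine étale object, and `subsingleton_sheafH_of_isLiftingClass` applies at the terminal object
`X` of `X_proét`. (For affine `X` the comparison needs no passage through `X_ét`.) [folklore] -/
theorem subsingleton_sheafH_of_isEtaleLiftingClass_of_isAffine [IsAffine X]
    {𝒢 : Set (Sheaf (Scheme.ProEt.topology X) Ab.{u + 1})} (h𝒢 : IsEtaleLiftingClass X 𝒢)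
    (G : Sheaf (Scheme.ProEt.topology X) Ab.{u + 1}) (hG : G ∈ 𝒢) (p : ℕ) :
    Subsingleton (G.H (p + 1)) :=
  haveI : IsAffine (Scheme.Etale.mk (𝟙 X) : X.Etale).left := ‹IsAffine X›
  haveI : HasSheafify (Scheme.ProEt.topology X) Ab.{u + 1} := inferInstance
  subsingleton_sheafH_of_isLiftingClass (J := Scheme.ProEt.topology X) (proEtTerminal X)
    (etaleToProet_obj_mem_etaleAffineObjects (Scheme.Etale.mk (𝟙 X))) h𝒢 G hG p

variable [(etaleToProetPullback X).Full] [(etaleToProetPullback X).Faithful]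

/-- **Degenerate Leray for `ν`.** Let `F` be an abelian étale sheaf (coefficients `Ab.{u+1}`) such
that `ν*F` lies in an étale lifting class (its iterated injective cosyzygies on `X_proét` have
liftable sections over affine étale objects) and `Hᵖ(X_ét, F) = 0` for all `p > 0`. Then
`Hᵖ(X_proét, ν*F) = 0` for all `p > 0`. Proof: `Hᵖ(X_proét, –) = Extᵖ(ℤ, –)` with
`ℤ = ν*ℤ` (`pullbackConstantSheafIso`); `Ext`-vanishing transfer along `ν* ⊣ ν_*`
(`subsingleton_ext_of_adjunction`, `ν_*` being exact on the injective cosyzygies of `ν*F`,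
`shortExact_map_proetToEtalePushforward`); and `ν_*ν*F ≅ F` (`ν*` fully faithful, Lemma 5.1.2).
This is the local-to-global step of Bhatt–Scholze Cor. 5.1.6 ("The first part follows from the
second part by checking it on sections", i.e. `K ≃ ν_*ν*K` is local on `X_ét` and
`RΓ(X_proét, ν*K) = RΓ(X_ét, ν_*ν*K)`), on Mathlib's `Ext`-groups.
[cite: BhattScholze2015, Cor. 5.1.6 (proof)] -/
theorem subsingleton_sheafH_etaleToProetPullback_of_mem
    {𝒢 : Set (Sheaf (Scheme.ProEt.topology X) Ab.{u + 1})} (h𝒢 : IsEtaleLiftingClass X 𝒢)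
    (F : Sheaf X.smallEtaleTopology Ab.{u + 1}) (hF : (etaleToProetPullback X).obj F ∈ 𝒢)
    (hb : ∀ q : ℕ, Subsingleton (F.H (q + 1))) (p : ℕ) :
    Subsingleton (((etaleToProetPullback X).obj F).H (p + 1)) := by
  -- `Extᵖ⁺¹(ℤ_E, ν_*ν*F) = 0` from `hb` and `F ≅ ν_*ν*F`
  have hA : ∀ m : ℕ, Subsingleton (Abelian.Ext.{u + 1}
      ((constantSheaf X.smallEtaleTopology Ab.{u + 1}).obj (AddCommGrpCat.of (ULift ℤ)))
      ((proetToEtalePushforward X Ab.{u + 1}).obj ((etaleToProetPullback X).obj F)) (m + 1)) :=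
    fun m => by
      haveI : IsIso (etaleToProetAdjunction X).unit :=
        (etaleToProetAdjunction X).unit_isIso_of_L_fully_faithful
      let e : F ≅ (proetToEtalePushforward X Ab.{u + 1}).obj ((etaleToProetPullback X).obj F) :=
        (asIso (etaleToProetAdjunction X).unit).app F
      exact @Equiv.subsingleton _ _ (extAddEquivOfIsoRight e (m + 1)).symm.toEquiv (hb m)
  -- transfer along `ν* ⊣ ν_*`
  have h := subsingleton_ext_of_adjunction (etaleToProetAdjunction X) 𝒢
    (fun S hS hJ hG => ⟨h𝒢.mem S hS hJ hG, shortExact_map_proetToEtalePushforward h𝒢 hS hJ hG⟩)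
    ((constantSheaf X.smallEtaleTopology Ab.{u + 1}).obj (AddCommGrpCat.of (ULift ℤ))) p
    ((etaleToProetPullback X).obj F) hF hA
  -- `ν*ℤ_E ≅ ℤ_P`
  exact @Equiv.subsingleton _ _ (extAddEquivOfIsoLeft
    ((pullbackConstantSheafIso X).app (AddCommGrpCat.of (ULift ℤ))) (p + 1)).toEquiv h

end Site

/-! ### Assembly: `(c)`, Cor. 5.1.6 and Prop. 5.6.2 from étale acyclicity and `Hᵖ(X_ét, ulift I) = 0` -/

section Assembly

variable (X : Scheme.{u})

/-- **Input (B) in lifting form.** `Hᵖ(X_ét, F) = 0` (`p > 0`, coefficients `Ab.{u+1}`) as soon as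
`F` is liftable over the final object `X` of `X_ét`: `subsingleton_sheafH_of_mem_liftable` at
`isTerminalEtaleMkId`. For `F = ulift I`, `I` injective in `Shv(X_ét, Ab.{u})`, this is the
form in which Cartan's criterion on `X_ét` (all covers; `ulift I` is Čech-acyclic by Milne III 2.4,
`Literature.Algebra.Homology.cechCochainComplex_exactAt_succ_of_injective`) delivers the
universe-change acyclicity `hb` below. [folklore] -/
theorem subsingleton_sheafH_etale_of_mem_liftable (F : Sheaf X.smallEtaleTopology Ab.{u + 1})
    (hF : F ∈ liftable X.smallEtaleTopology ({Scheme.Etale.mk (𝟙 X)} : Set X.Etale)) (p : ℕ) :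
    Subsingleton (F.H (p + 1)) :=
  subsingleton_sheafH_of_mem_liftable (𝔘 := ({Scheme.Etale.mk (𝟙 X)} : Set X.Etale))
    (isTerminalEtaleMkId X) (Set.mem_singleton _) F hF p

/-- **The acyclicity `(c)` of Bhatt–Scholze Cor. 5.1.6 for `X`, from (A) étale acyclicity of `ν*I`
on `X_proét` and (B) `Hᵖ(X_ét, ulift I) = 0`**: `Hᵖ⁺¹(X_proét, ν*(ulift I)) = 0`. Degenerate
Leray (`subsingleton_sheafH_etaleToProetPullback_of_mem`) for the largest étale lifting class,
with `ν*` fully faithful (`full_faithful_etaleToProetPullback_holds`, Lemma 5.1.2). Here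
(A) — `ν*(ulift I) ∈ etaleAcyclic X`: the iterated injective cosyzygies of `ν*(ulift I)` have
liftable sections over affine étale objects — is the printed "`Hᵖ(U, ν*I) = 0` for
`U ∈ X_proét^aff`" for the affine étale `U` (Cartan's criterion over ind-étale covers,
Thm. 2.3.4, Lemma 5.1.1, Čech-acyclicity of `I`), and (B) is the independence of étale
cohomology from the coefficient universe on injectives; neither needs `I` injective here.
[cite: BhattScholze2015, Cor. 5.1.6 (proof)] -/
theorem subsingleton_sheafH_etaleToProetPullbackULift_of_etaleAcyclic
    (I : Sheaf X.smallEtaleTopology Ab.{u})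
    (ha : (etaleToProetPullbackULift X).obj I ∈ etaleAcyclic X)
    (hb : ∀ q : ℕ, Subsingleton (((uliftEtSheaf X).obj I).H (q + 1))) (p : ℕ) :
    Subsingleton (((etaleToProetPullbackULift X).obj I).H (p + 1)) := by
  haveI := (full_faithful_etaleToProetPullback_holds.{u} X).1
  haveI := (full_faithful_etaleToProetPullback_holds.{u} X).2
  exact subsingleton_sheafH_etaleToProetPullback_of_mem (isLiftingClass_liftable _)
    ((uliftEtSheaf X).obj I) ha hb p

/-- **For affine `X`, (A) alone gives `(c)`**: `Hᵖ⁺¹(X_proét, ν*(ulift I)) = 0` as soon as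
`ν*(ulift I)` is étale-acyclic (`X` is then itself an affine étale object; no passage through
`X_ét`). [cite: BhattScholze2015, Cor. 5.1.6 (proof)] -/
theorem subsingleton_sheafH_etaleToProetPullbackULift_of_etaleAcyclic_of_isAffine [IsAffine X]
    (I : Sheaf X.smallEtaleTopology Ab.{u})
    (ha : (etaleToProetPullbackULift X).obj I ∈ etaleAcyclic X) (p : ℕ) :
    Subsingleton (((etaleToProetPullbackULift X).obj I).H (p + 1)) :=
  subsingleton_sheafH_of_isEtaleLiftingClass_of_isAffine (isLiftingClass_liftable _) _ ha p

/-- **Bhatt–Scholze Cor. 5.1.6 (`nonempty_addEquiv_sheafH_etaleToProetPullback`) from (A) and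
(B)** for injective étale sheaves: with `nonempty_addEquiv_sheafH_etaleToProetPullback_of_facts`
(dimension shifting, `ν*` exact and fully faithful — all proved) the named fact is reduced to
(A) the étale acyclicity of `ν*(ulift I)` on `X_proét` — sections of its iterated injective
cosyzygies lift over affine étale objects — and (B) `Hᵖ(X_ét, ulift I) = 0`, for `I` injective
in `Shv(X_ét, Ab.{u})`. [cite: BhattScholze2015, Cor. 5.1.6] -/
theorem nonempty_addEquiv_sheafH_etaleToProetPullback_of_etaleAcyclic
    (ha : ∀ (X : Scheme.{u}) (I : Sheaf X.smallEtaleTopology Ab.{u}), Injective I →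
      (etaleToProetPullbackULift X).obj I ∈ etaleAcyclic X)
    (hb : ∀ (X : Scheme.{u}) (I : Sheaf X.smallEtaleTopology Ab.{u}), Injective I →
      ∀ q : ℕ, Subsingleton (((uliftEtSheaf X).obj I).H (q + 1))) :
    nonempty_addEquiv_sheafH_etaleToProetPullback.{u} :=
  nonempty_addEquiv_sheafH_etaleToProetPullback_of_facts
    full_faithful_etaleToProetPullback_holds fun X I hI p =>
      subsingleton_sheafH_etaleToProetPullbackULift_of_etaleAcyclic X I (ha X I hI) (hb X I hI) p

/-- **Bhatt–Scholze Prop. 5.6.2 for `(ℤ/ℓᵐ)_m` (`ellAdicCohomology_limOneSequence`) from (A) and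
(B)**, through `ellAdicCohomology_limOneSequence_of_acyclic` (the pro-étale `lim¹` sequence,
repleteness, Lemma 4.2.12, Lemma 6.8.2 and the naturality of the comparison are proved in this
cluster). [cite: BhattScholze2015, Prop. 5.6.2 and Cor. 5.1.6] -/
theorem ellAdicCohomology_limOneSequence_of_etaleAcyclic
    (ha : ∀ (X : Scheme.{u}) (I : Sheaf X.smallEtaleTopology Ab.{u}), Injective I →
      (etaleToProetPullbackULift X).obj I ∈ etaleAcyclic X)
    (hb : ∀ (X : Scheme.{u}) (I : Sheaf X.smallEtaleTopology Ab.{u}), Injective I →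
      ∀ q : ℕ, Subsingleton (((uliftEtSheaf X).obj I).H (q + 1))) :
    ellAdicCohomology_limOneSequence.{u} :=
  ellAdicCohomology_limOneSequence_of_acyclic fun X I hI p =>
    subsingleton_sheafH_etaleToProetPullbackULift_of_etaleAcyclic X I (ha X I hI) (hb X I hI) p

end Assembly

end Literature.AlgebraicGeometry.Motives

end
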